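import Mathlib
import HarnessLib
import HarnessLib.Audit
import Summits.HodgeConjecture.Statement
import Literature.AlgebraicGeometry.Motives.AbelianVariety
import Literature.AlgebraicGeometry.Motives.FamiliesVHS
import Literature.AlgebraicGeometry.Motives.CartierDivisorClassPullback
import Literature.AlgebraicGeometry.HodgeTheory.CycleDegreeSpan
import Literature.AlgebraicGeometry.HodgeTheory.GlobalInvariantCycles
import Literature.AlgebraicGeometry.HodgeTheory.HodgeModelExistence
import Literature.AlgebraicGeometry.HodgeTheory.IsoTransport
import HarnessLib.Audit.Status.Attr

/-!
Route: CMComplexitySaturation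

# Route CMComplexitySaturation — Uniform CM complexity — bounded-degree cycles at dense CM fibres
saturate the algebraicity locus of a flat Hodge class

It suffices to show X = UniformCMComplexity ∧ MumfordTateFamily ∧ BoundedStrataClosed, modulo the
two declared RESIDUALS
CMAbelianHodge (the Hodge conjecture for CM abelian varieties; shared item
stmt-HodgeConjecture-3052) and AbelianComplement
(HC for all complex abelian varieties ⇒ HC; shared item stmt-HodgeConjecture-10452) and the proved
support HodgeModels (stmt-HodgeConjecture-1943).
Given a Hodge class ω₀ on a complex abelian variety A, MumfordTateFamily puts A = 𝒜_x₀ in a smooth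
projective family f : 𝒜 → V of abelian
varieties over a smooth irreducible quasi-projective base with ONE global polarisation H, a
Zariski-dense set of CM fibres, and a global class Ω
extending ω₀ that is rational of type (p,p) on every fibre. At the CM fibres Ω_s is algebraic
(residual). UniformCMComplexity — the new lever — says
ONE degree δ (w.r.t. H) suffices on a still Zariski-dense set of CM fibres; BoundedStrataClosed says
the δ-stratum {s | Ω_s ∈ cycleDegreeSpan_δ} is
Zariski closed; so it is all of V and ω₀ = Ω_x₀ is algebraic. This realises the markdown-wave sketch
cm-complexity-saturation (reader PASS 3/3/3/4).
Lean: `UniformCMComplexity ∧ MumfordTateFamily ∧ BoundedStrataClosed`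

## Assembly
The deciding theorem `closes` (glue.lean, elaborated rc 0, no sorry) is twenty lines of logic over
tree lemmas: `AbelianComplement` reduces to an abelian variety A;
`hodgeConjectureFor_iff_of_isSmoothProjective (HodgeModels …)` unfolds the goal to "every rational
(p,p) class ω₀ on A is algebraic"; `MumfordTateFamily` gives the datum (f, x₀, e : A.X ≅ 𝒜_x₀, H,
CM, Ω); `CMAbelianHodge` transported along `B.X ≅ 𝒜_s`
(`forall_hodgeClass_mem_algebraicClasses_iff_of_iso`) gives algebraicity of Ω_s at s ∈ CM;
`UniformCMComplexity` gives δ with the δ-cheap CM fibres dense; `BoundedStrataClosed` makes the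
δ-stratum closed, hence `= Set.univ`, hence x₀ is in it; `cycleDegreeSpan_le_algebraicClasses` and
`mem_algebraicClasses_map_iff_of_iso e` finish. The Assembly item records the same implication as a
statement.

Rationale: WHY THIS LINE. Deligne's 1982 proof that Hodge classes on abelian varieties are absolute Hodge
(Deligne1982HodgeCycles; CharlesSchnell2014Notes §3, arXiv:1101.3647 p.22) runs: Mumford–Tate family
of A ⇝ CM point, then Principle B, which works because "absolute Hodge" for a flat section is
decided at one point; "algebraic" is not, and the variational Hodge conjecture is wide open
(arXiv:1101.3647 p.14). This line replaces Principle B by a UNIFORMITY input: "algebraic of H-degree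
≤ δ" is a Zariski-CLOSED condition on the base (relative Chow varieties in bounded degree:
Kollar1996 Ch. I, Fulton1998 Ex. 19.1.1), so Zariski density of CM points in Shimura varieties
(Mumford1969NoteShimura, Deligne1982HodgeCycles) saturates as soon as the degree is bounded on a
dense set of CM fibres — that bound is the single new crux. Imported areas: Shimura-variety geometry
(MT families, CM density), intersection theory/Chow schemes (bounded-degree strata), Hodge theory in
families (global invariant cycles: tree facts `deligne_globalInvariantCycles`,
`charlesSchnell_hodgeClass_of_flat`). What it does that prior routes do not: RankFourFaces files
HC(CM AV) → HC(AV) as ONE opaque crux CMToAbelian (stmt-HodgeConjecture-16267); this route is an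
alternative decomposition of exactly that node into a degree-uniformity statement plus two geometric
theorems, sharing CMAbelianHodge/AbelianComplement/HodgeModels; QbarEnvelope and Voisin2007HodgeLoci
Prop. 1.7 instead need HC for a total space over ℚ̄; HeckeOrbitCompactness.AnchorDegreeBound bounds
degrees along ONE Hecke orbit of split Weil classes, not at a dense CM set, and has no saturation
step. Negatives index (3 entries) untouched.

RANKED CRUXES. #2 UniformCMComplexity (crux) — For a smooth projective family f : 𝒜 → V of abelian
varieties (relative dimension n) with integral quasi-projective total space over a smooth
irreducible quasi-projective base, ONE global Cartier divisor H ample on every fibre, a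
Zariski-dense set D of CM fibres, and a global class Ω ∈ H^2p(𝒜) whose restriction to every fibre is
rational of type (p,p) and which is ALGEBRAIC on the fibres over D: there is one δ such that the
fibres s ∈ D where Ω_s lies in the ℚ-span of classes of subvarieties of H_s-degree ≤ δ (tree
`cycleDegreeSpan`) are still Zariski dense in V. (Sketch X1; the only load-bearing novelty.)
[difficulty: XL] (why it might fail: Known only via HC on all fibres (then BoundedStrataClosed +
Baire give δ); false iff some CM-dense family carries a fibrewise-algebraic flat class whose minimal
H-degree is unbounded on EVERY Zariski-dense subset of the CM fibres — no bound is known even for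
split Weil classes.) [Deligne1982HodgeCycles, CharlesSchnell2014Notes, arXiv:1101.3647,
Voisin2007HodgeLoci, Mumford1969NoteShimura]
#3 MumfordTateFamily (crux) — Every complex abelian variety A (smooth projective of dimension A.dim)
is, on the nose, a fibre A ≅ 𝒜_x₀ of a smooth projective family of abelian varieties f : 𝒜 → V with
𝒜 integral quasi-projective, V smooth irreducible quasi-projective, a global Cartier divisor H ample
on all fibres, a Zariski-dense set of CM fibres of dimension A.dim, and such that every rational
(p,p)-class ω₀ on A is the restriction of a global class Ω on 𝒜 that is rational of type (p,p) on
every fibre (the Hodge-generic Mumford–Tate/Kuga family at neat level + Deligne's global invariant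
cycles + Charles–Schnell Prop. 34). (Sketch G1.) [difficulty: XL] (why it might fail: The extension
clause is for ALL fibres and all p at once: it needs MT(𝒜_s) ⊆ MT(A) along the whole irreducible
base, a fine neat-level family with quasi-projective integral total space and A ≅ 𝒜_x₀ exactly (not
up to isogeny), and CM density at that level; the Shimura input is unformalised (XL).)
[Mumford1969NoteShimura, Deligne1982HodgeCycles, CharlesSchnell2014Notes, FaltingsChai1990,
ClozelUllmo2005]
#4 BoundedStrataClosed (crux) — In such a family, for every global class Ω, every p and every δ, the
set of s ∈ V(ℂ) with Ω_s ∈ cycleDegreeSpan(𝒜_s, H_s, δ, p) is the set of complex points of a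
Zariski-closed subset of V (bounded-degree relative Chow variety is proper over V with finitely many
components, cycle classes are locally constant on components, image of proper is closed). (Sketch
G2.) [difficulty: L] (why it might fail: Needs properness + finitely many components of the relative
Chow scheme in H-degree ≤ δ and locally constant cycle classes; the tree's
`cycleDegreeSpan`/`subvarietyDegree` must match Chow degree exactly (purity), else strata are only
constructible or closed only after saturating δ.) [Kollar1996, Fulton1998,
CattaniDeligneKaplan1995JAMS, Voisin2007HodgeLoci]
#5 CMAbelianHodge (crux) — RESIDUAL (shared verbatim with RankFourFaces / SupersingularIsotypicLift,
stmt-HodgeConjecture-3052): the Hodge conjecture for complex abelian varieties whose endomorphism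
algebra contains a commutative reduced ℚ-subalgebra of rank 2·dim (CM abelian varieties). Not
attacked by this route; declared residual at the tribunal. [difficulty: open-problem] (why it might
fail: It is HC for CM abelian varieties — open; by André 1992 it reduces to split Weil classes on CM
abelian varieties of Weil type, known in dimension ≤ 4 (Markman 2025) and sporadic Weil cases only;
a non-algebraic Weil class on a CM sixfold refutes it and the summit.) [Deligne1982HodgeCycles,
Markman2025SecantWeil, vanGeemen1994HodgeAV, MoonenZarhin1999]
#6 AbelianComplement (crux) — RESIDUAL (shared verbatim with ConservativityLefschetz,
stmt-HodgeConjecture-10452, conditional form): the Hodge conjecture for all complex abelian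
varieties implies the Hodge conjecture. Not attacked by this route; declared residual (the
complement-form stmt-15889 is summit-equivalent by the landed
`abelianComplement_iff_hodgeConjecture` and is deliberately NOT used). [difficulty: open-problem]
(why it might fail: It is the non-abelian remainder of the summit (surfaces of general type squared,
Calabi–Yau, …) given HC(AV): no reduction of general varieties to abelian ones is known beyond
André's motivated classes; it cannot fail without the summit failing off abelian varieties.)
[Andre1996Motifs, Deligne1982HodgeCycles]
#9 HodgeModels (support) — Shared support stmt-HodgeConjecture-1943 (PROVED in Theorems:
`nodalSupport_hodgeModels_proof`): every ℂ-scheme carries the tree's Hodge-model data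
`nonempty_hodgeModel n X`, used only to unfold `HodgeConjectureFor` via
`hodgeConjectureFor_iff_of_isSmoothProjective`. [difficulty: provable-now]
[Literature.AlgebraicGeometry.HodgeTheory.HodgeModelExistence]

TWO-LAYER PLAN. Foreseen glued splits (each already elaborates as a BC3 skeleton in the seat folder,
`_of` proved, sorries = stubs): UniformCMComplexity ⇐ FiniteComplexity (every smooth projective X
with ample P has algebraicClasses ≤ ⨆_δ cycleDegreeSpan_δ; Fulton 19.1.1) → LonelySaturation (an
infinite set of Zariski-isolated points of D is dense; Noetherian) → CheapCMPoints (the open core: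
pointwise-cheap CM fibres are δ-cheap on a dense set or on infinitely many lonely points);
MumfordTateFamily ⇐ HodgeGenericFamily (geometry + connected base + flat extension with rational
restrictions; Shimura/Deligne) → HodgeTypeSpreads (= `charlesSchnell_hodgeClass_of_flat`);
BoundedStrataClosed ⇐ StrataProperImage (the δ-stratum is the image on ℂ-points of a proper W → V;
relative Chow) → ComplexPointsImageClosed (image of a proper morphism of quasi-projective ℂ-schemes
is Zariski closed on ℂ-points; Chevalley + Nullstellensatz).

KILL CRITERIA. ¬UniformCMComplexity (a CM-dense family of abelian varieties with a
fibrewise-algebraic flat class whose minimal H-degree is unbounded on every dense CM subset — e.g.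
split Weil classes on B₀ × B₀ over A_n with unbounded minimal degree) closes the route outright
(close --reason refuted:UniformCMComplexity) and is a theorem worth having. ¬BoundedStrataClosed as
typed (strata only constructible) forces a pivot: restate UCM/BSC with Zariski closures of strata
(same glue). ¬MumfordTateFamily as typed (no fine family with A an exact fibre and quasi-projective
integral total space) forces a restatement up to isomorphism of fibres/level cover. CMToAbelian
(stmt-HodgeConjecture-16267) proved elsewhere moots the three open cruxes; a refutation of
CMAbelianHodge refutes the summit.

NOT DECOMPOSED YET. The Shimura-theoretic construction inside MumfordTateFamily (neat level,
toroidal/Baily–Borel facts, CM density at finite level), the Chow-scheme facts inside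
BoundedStrataClosed, and the o-minimal / counting content one would try on CheapCMPoints are
deliberately not itemised: they are layer-2 children or `--supports` lemmas once a prover takes the
crux. No SaturationDatum interface is introduced: the datum is the existential package of
MumfordTateFamily, consumed verbatim by the other two cruxes (density + irreducibility + one global
H + one global Ω are explicit binders, per the reader verdict).

CHEAPEST FALSIFIER. (i) p = 1 sanity (run by hand, passes): a flat rational (1,1)-class is NS on
every fibre and L = (L+3H) − 3H exhibits it in cycleDegreeSpan_δ with δ = (L+3H)·H^(n−1) + 3Hⁿ
constant in the family — UCM/BSC consistent for divisors. (ii) The decidable family (BC5 rung,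
plan-only stub `stub_rung_splitWeilSquares`): for B₀ ∈ A_n(t) and the split Weil plane on B₀ × B₀,
is the minimal (H⊠H)-degree of spanning cycles bounded by M(n,d,t)? The divisor-polynomial
presentation (Schoen/van Geemen) predicts yes; a certified NO for some n kills UniformCMComplexity
(CM squares are CM and dense). (iii) Typed-vacuity: V(ℂ) = ∅ would make density vacuous, but
MumfordTateFamily's `e : A.X ≅ fiberOver f x₀` forces a point; D = ∅ is excluded by density +
`IrreducibleSpace`; checked by the BC7 P2/P3 batteries (CLEAN).

NUMBERS. Known regime of S on abelian varieties: dimension ≤ 4 (Markman 2025, arXiv:2502.03415 p.2),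
simple of prime dimension (Tankeev–Ribet), products of elliptic curves (Tate) — vanGeemen1994HodgeAV
Thms 4.2–4.12; the BC5 rung lives on B₀ × B₀ with dim B₀ = n ≥ 4 (dimension ≥ 8, squares of
Mumford/Weil-type fourfolds included).

DEFINITION REQUESTS. None at open: every crux is typed over tree notions (SchemeOver,
fiberOver/fiberι, IsSmoothProjectiveFamily, IsQuasiProjectiveOver,
CartierDivisor.classPullback/IsAmple, complexBetti, IsRationalClass, IsOfHodgeType,
algebraicClasses, cycleDegreeSpan, IsZariskiClosedOnPoints, AbelianVariety.endAlgebra). The reader's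
missing notions (Shimura datum of Hodge type as a fine moduli space; relative Chow scheme) are
folded into the EXISTENTIAL statements MumfordTateFamily / BoundedStrataClosed rather than posited
as interfaces; a prover who wants `Literature.NumberTheory.ShimuraVarieties.*` vocabulary files the
definition item then.

Novelty: Searches (2026-08-17): lit search --hybrid "uniform bound degree algebraic cycles representing Hodge
classes CM points Shimura variety family" (10 docs: GGK 2012 pp 235–239, Green–Murre–Voisin 1994,
Voisin 2003 II, Carlson–Müller-Stach–Peters 2017, Kerr–Pearlstein 2016, Deligne–Milne–Ogus–Shih 1982
— none states a degree-uniformity-at-CM-points principle); lit vsearch "<UCM in prose>" (10 docs,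
nearest GGK p.230, Pila 2022 pp 164–169 (André–Oort), no match); lit search "Voisin Hodge loci and
absolute Hodge classes" → paper:arxiv-math_0605766 read pp 2–3, 7 (Prop. 1.7); lit read
arXiv:1101.3647 pp 14, 22 (VHC status; Deligne's reduction); lit read GGK pp 228–242 (VIII.B CM
density, withdrawn conjecture VIII.B.2); lit galaxy search "variational Hodge conjecture" --star all
(pdf: 2 hits — galaxy:pdf:-8405055998839152860 Deligne–Milne notes, galaxy:pdf:5937747177045521880
irrelevant; panama/crabby queues saturated > 90 s, 3 attempts); lean search/grep of Theses:
RankFourFaces.CMToAbelian, HeckeOrbitCompactness.AnchorDegreeBound, QbarEnvelope,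
ConservativityLefschetz, AnchorTransport read.
Nearest prior art found: Deligne1982HodgeCycles (MT family + Principle B for absolute Hodge classes
= our G1 datum with AH in place of algebraic); Voisin2007HodgeLoci Prop. 1.7 (algebraicity spreads
from HC of a ℚ̄-total space via global invariant cycles — one variety, no density);
CattaniDeligneKaplan1995JAMS (the (p,p)-locus is algebraic — the dual side); in-tree
RankFourFaces.CMToAbelian (stm  [refs: 1101.3647, paper:arxiv-math_0605766]

Barriers (technique_class: variational-hodge, cm-density, chow-bound, hodge-locus-bundle): - technique_class: variational-hodge, cm-density, chow-bound, hodge-locus-bundle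
- Literature.Barriers.HodgeConjecture.hodgeClassesAreAbsoluteFor_abelianVariety: outside its class —
Deligne's theorem caps the MT-family + Principle B method at "absolute Hodge" because only AH-ness
of a flat section is a one-point condition; this line does not transport algebraicity by flatness at
all but by a closed bounded-degree stratum meeting a dense set, and the barrier (no
Galois-conjugation test refutes HC on AV) does not quantify over UCM/MTF/BSC.
- Literature.Barriers.HodgeConjecture.Andre1996_hodgeClassesOnAbelianVarieties_motivated: outside
its class — André reduces HC(AV) to the Lefschetz-type statement on abelian pencils (motivated ⇒
algebraic); our sufficient input is degree uniformity at CM fibres, not an algebraicity statement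
for the Lefschetz involution; the barrier is refutation-side and does not constrain a proof line.
- Literature.Barriers.HodgeConjecture.CattaniDeligneKaplan1995_hodgeLocus_algebraicFor: not an
obstruction but the dual fact — CDK make the (p,p)-locus algebraic; BoundedStrataClosed asks the
same of the bounded-degree ALGEBRAICITY locus, which CDK neither give nor forbid; UCM is exactly
what bridges the countable union of such strata to one stratum.
- Literature.Barriers.HodgeConjecture.Weil1977_exceptionalHodgeClasses /
Literature.Barriers.HodgeConjecture.Mumford1968_simpleFourfold_exceptionalHodgeClasses: evaded in
the statements — complexity is measured i

sub-problem: HodgeConjecture · status: draft · opened planner-type-b949f9ea46-0 2026-08-17T19:11:23Z · rev 0 · ledger route-HodgeConjecture-CMComplexitySaturation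
GENERATED by the gate from the ledger (D-0016/17). Provers cite these decls: `theorem foo : Summit.HodgeConjecture.HodgeConjecture.Theses.CMComplexitySaturation.<Decl> := …` in Summits/HodgeConjecture/HodgeConjecture/Theorems/<Name>.lean.
-/

namespace Summit.HodgeConjecture.HodgeConjecture.Theses.CMComplexitySaturation

open scoped BigOperators Topology Manifold Classical MeasureTheory ProbabilityTheory Matrix InnerProductSpace ComplexConjugate ContinuousMap
open Filter Set Function TopologicalSpace MeasureTheory

attribute [summit_statement] _root_.HodgeConjecture

/-- item stmt-HodgeConjecture-20096 · crux · rank 2 · open · by planner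
why it might fail: Known only via HC on all fibres (then BoundedStrataClosed + Baire give δ); false iff some CM-dense family carries a fibrewise-algebraic flat class whose minimal H-degree is unbounded on EVERY Zariski-dense subset of the CM fibres — no bound is known even for split Weil classes.
sources: Deligne1982HodgeCycles, CharlesSchnell2014Notes, arXiv:1101.3647, Voisin2007HodgeLoci, Mumford1969NoteShimura
[crux] For a smooth projective family f : 𝒜 → V of abelian varieties (relative dimension n) with
integral quasi-projective total space over a smooth irreducible quasi-projective base, ONE global
Cartier divisor H ample on every fibre, a Zariski-dense set D of CM fibres, and a global class Ω ∈
H^2p(𝒜) whose restriction to every fibre is rational of type (p,p) and which is ALGEBRAIC on the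
fibres over D: there is one δ such that the fibres s ∈ D where Ω_s lies in the ℚ-span of classes of
subvarieties of H_s-degree ≤ δ (tree `cycleDegreeSpan`) are still Zariski dense in V. (Sketch X1;
the only load-bearing novelty.) [difficulty: XL] -/
@[route_item "route-HodgeConjecture-CMComplexitySaturation", crux]
def UniformCMComplexity : Prop :=
  open Literature.AlgebraicGeometry.Motives Literature.AlgebraicGeometry.HodgeTheory CategoryTheory in ∀ ⦃𝒜 V : SchemeOver ℂ⦄ [AlgebraicGeometry.IsIntegral 𝒜.left] (f : 𝒜 ⟶ V) (n : ℕ), IsSmoothProjectiveFamily f n → IsQuasiProjectiveOver 𝒜 → IsQuasiProjectiveOver V → AlgebraicGeometry.Smooth V.hom → IrreducibleSpace V.left → ∀ [∀ s : ComplexPoints V, AlgebraicGeometry.IsIntegral (fiberOver f s).left] [∀ s : ComplexPoints V, AlgebraicGeometry.LocallyOfFiniteType (fiberOver f s).hom] (H : CartierDivisor 𝒜.left), (∀ s : ComplexPoints V, (H.classPullback (fiberι f s).left).IsAmple) → (∀ s : ComplexPoints V, ∃ B : AbelianVariety ℂ, Nonempty (B.X ≅ fiberOver f s)) → ∀ (D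 : Set (ComplexPoints V)), (∀ Z : Set (ComplexPoints V), IsZariskiClosedOnPoints V Z → D ⊆ Z → Z = Set.univ) → (∀ s ∈ D, ∃ B : AbelianVariety ℂ, Nonempty (B.X ≅ fiberOver f s) ∧ ∃ S : Subalgebra ℚ B.endAlgebra, IsReduced ↥S ∧ (∀ x ∈ S, ∀ y ∈ S, x * y = y * x) ∧ Module.finrank ℚ ↥S = 2 * B.dim) → ∀ (p : ℕ) (Ω : complexBetti 𝒜 (2 * p)), (∀ s : ComplexPoints V, IsRationalClass (complexBetti.map (fiberι f s) (2 * p) Ω) ∧ IsOfHodgeType n (fiberOver f s) (2 * p) p p (complexBetti.map (fiberι f s) (2 * p) Ω)) → (∀ s ∈ D, complexBetti.map (fiberι f s) (2 * p) Ω ∈ algebraicClasses (fiberOver f s) p) → ∃ δ : ℕ, ∀ Z : Set (ComplexPoints V), IsZariskiClosedOnPoints V Z → {s ∈ D | complexBetti.map (fiberι f s) (2 * p) Ω ∈ cycleDegreeSpan (fiberOver f s) (H.classPullback (fiberι f s).left) δ p} ⊆ Z → Z = Set.univ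

/-- item stmt-HodgeConjecture-20097 · crux · rank 3 · open · by planner
why it might fail: The extension clause is for ALL fibres and all p at once: it needs MT(𝒜_s) ⊆ MT(A) along the whole irreducible base, a fine neat-level family with quasi-projective integral total space and A ≅ 𝒜_x₀ exactly (not up to isogeny), and CM density at that level; the Shimura input is unformalised (XL).
sources: Mumford1969NoteShimura, Deligne1982HodgeCycles, CharlesSchnell2014Notes, FaltingsChai1990, ClozelUllmo2005
[crux] Every complex abelian variety A (smooth projective of dimension A.dim) is, on the nose, a
fibre A ≅ 𝒜_x₀ of a smooth projective family of abelian varieties f : 𝒜 → V with 𝒜 integral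
quasi-projective, V smooth irreducible quasi-projective, a global Cartier divisor H ample on all
fibres, a Zariski-dense set of CM fibres of dimension A.dim, and such that every rational
(p,p)-class ω₀ on A is the restriction of a global class Ω on 𝒜 that is rational of type (p,p) on
every fibre (the Hodge-generic Mumford–Tate/Kuga family at neat level + Deligne's global invariant
cycles + Charles–Schnell Prop. 34). (Sketch G1.) [difficulty: XL] -/
@[route_item "route-HodgeConjecture-CMComplexitySaturation", crux]
def MumfordTateFamily : Prop :=
  open Literature.AlgebraicGeometry.Motives Literature.AlgebraicGeometry.HodgeTheory CategoryTheory in ∀ (A : AbelianVariety ℂ), IsSmoothProjective A.dim A.X → ∃ (𝒜 V : SchemeOver ℂ) (_ : AlgebraicGeometry.IsIntegral 𝒜.left) (f : 𝒜 ⟶ V) (x₀ : ComplexPoints V) (e : A.X ≅ fiberOver f x₀) (_ : ∀ s : ComplexPoints V, AlgebraicGeometry.IsIntegral (fiberOver f s).left) (_ : ∀ s : ComplexPoints V, AlgebraicGeometry.LocallyOfFiniteType (fiberOver f s).hom) (H : CartierDivisor 𝒜.left) (CM : Set (ComplexPoints V)), IsSmoothProjectiveFamily f A.dim ∧ IsQuasiProjectiveOver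 𝒜 ∧ IsQuasiProjectiveOver V ∧ AlgebraicGeometry.Smooth V.hom ∧ IrreducibleSpace V.left ∧ (∀ s : ComplexPoints V, (H.classPullback (fiberι f s).left).IsAmple) ∧ (∀ s : ComplexPoints V, ∃ B : AbelianVariety ℂ, Nonempty (B.X ≅ fiberOver f s)) ∧ (∀ Z : Set (ComplexPoints V), IsZariskiClosedOnPoints V Z → CM ⊆ Z → Z = Set.univ) ∧ (∀ s ∈ CM, ∃ B : AbelianVariety ℂ, Nonempty (B.X ≅ fiberOver f s) ∧ B.dim = A.dim ∧ IsSmoothProjective B.dim B.X ∧ ∃ S : Subalgebra ℚ B.endAlgebra, IsReduced ↥S ∧ (∀ x ∈ S, ∀ y ∈ S, x * y = y * x) ∧ Module.finrank ℚ ↥S = 2 * B.dim) ∧ ∀ (p : ℕ) (ω₀ : complexBetti A.X (2 * p)), IsRationalClass ω₀ → IsOfHodgeType A.dim A.X (2 * p) p p ω₀ → ∃ Ω : complexBetti 𝒜 (2 * p), complexBetti.map e.hom (2 * p) (complexBetti.map (fiberι f x₀) (2 * p) Ω) = ω₀ ∧ ∀ s : ComplexPoints V, IsRationalClass (complexBetti.map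 (fiberι f s) (2 * p) Ω) ∧ IsOfHodgeType A.dim (fiberOver f s) (2 * p) p p (complexBetti.map (fiberι f s) (2 * p) Ω)

/-- item stmt-HodgeConjecture-20098 · crux · rank 4 · open · by planner
why it might fail: Needs properness + finitely many components of the relative Chow scheme in H-degree ≤ δ and locally constant cycle classes; the tree's `cycleDegreeSpan`/`subvarietyDegree` must match Chow degree exactly (purity), else strata are only constructible or closed only after saturating δ.
sources: Kollar1996, Fulton1998, CattaniDeligneKaplan1995JAMS, Voisin2007HodgeLoci
[crux] In such a family, for every global class Ω, every p and every δ, the set of s ∈ V(ℂ) with Ω_s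
∈ cycleDegreeSpan(𝒜_s, H_s, δ, p) is the set of complex points of a Zariski-closed subset of V
(bounded-degree relative Chow variety is proper over V with finitely many components, cycle classes
are locally constant on components, image of proper is closed). (Sketch G2.) [difficulty: L] -/
@[route_item "route-HodgeConjecture-CMComplexitySaturation", crux]
def BoundedStrataClosed : Prop :=
  open Literature.AlgebraicGeometry.Motives Literature.AlgebraicGeometry.HodgeTheory CategoryTheory in ∀ ⦃𝒜 V : SchemeOver ℂ⦄ [AlgebraicGeometry.IsIntegral 𝒜.left] (f : 𝒜 ⟶ V) (n : ℕ), IsSmoothProjectiveFamily f n → IsQuasiProjectiveOver 𝒜 → IsQuasiProjectiveOver V → AlgebraicGeometry.Smooth V.hom → ∀ [∀ s : ComplexPoints V, AlgebraicGeometry.IsIntegral (fiberOver f s).left] [∀ s : ComplexPoints V, AlgebraicGeometry.LocallyOfFiniteType (fiberOver f s).hom] (H : CartierDivisor 𝒜.left), (∀ s : ComplexPoints V, (H.classPullback (fiberι f s).left).IsAmple) → ∀ (p : ℕ) (Ω : complexBetti 𝒜 (2 * p)) (δ : ℕ), IsZariskiClosedOnPoints V {s : ComplexPoints V | complexBetti.map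 (fiberι f s) (2 * p) Ω ∈ cycleDegreeSpan (fiberOver f s) (H.classPullback (fiberι f s).left) δ p}

/-- item stmt-HodgeConjecture-3052 · crux · rank 5 · open · by planner
why it might fail: It is HC for CM abelian varieties — open; by André 1992 it reduces to split Weil classes on CM abelian varieties of Weil type, known in dimension ≤ 4 (Markman 2025) and sporadic Weil cases only; a non-algebraic Weil class on a CM sixfold refutes it and the summit.
sources: Deligne1982HodgeCycles, Markman2025SecantWeil, vanGeemen1994HodgeAV, MoonenZarhin1999
[support] MILESTONE: the Hodge conjecture for complex abelian varieties of CM type (End⁰(A) ⊇ a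
commutative reduced ℚ-subalgebra of dimension 2 dim A; smooth-projectivity quantified as a witness
as in the barrier files). Open in general (Pohlmann1968: equivalent to the Tate conjecture for A;
Milne1999: implies Tate for all abelian varieties over finite fields; known for nondegenerate CM
types, prime dimension, special Weil-type examples — vanGeemen1994HodgeAV §4). In this route it is
LIFT ∧ ENV on the CM family: ENV holds by CM idempotents (Pohlmann1968), LIFT is to come from ALG
via primes of supersingular reduction (Frobenius = complex conjugation in the reflex closure;
positive density, unramified, p > g + 6) where A₁ ~ E^g and H^{2p} is spanned by products of
divisors. Sources: Pohlmann1968, Milne1999, Deligne1982HodgeCycles, vanGeemen1994HodgeAV. -/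
@[route_item "route-HodgeConjecture-CMComplexitySaturation", crux]
def CMAbelianHodge : Prop :=
  ∀ (A : Literature.AlgebraicGeometry.Motives.AbelianVariety ℂ), Literature.AlgebraicGeometry.Motives.IsSmoothProjective A.dim A.X → (∃ S : Subalgebra ℚ A.endAlgebra, IsReduced ↥S ∧ (∀ x ∈ S, ∀ y ∈ S, x * y = y * x) ∧ Module.finrank ℚ ↥S = 2 * A.dim) → Literature.AlgebraicGeometry.HodgeTheory.HodgeConjectureFor A.dim A.X

/-- item stmt-HodgeConjecture-10452 · crux · rank 6 · open · by planner
why it might fail: It is the non-abelian remainder of the summit (surfaces of general type squared, Calabi–Yau, …) given HC(AV): no reduction of general varieties to abelian ones is known beyond André's motivated classes; it cannot fail without the summit failing off abelian varieties.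
sources: Andre1996Motifs, Deligne1982HodgeCycles
[support] NOT CLAIMED BY THIS ROUTE — the remainder of the summit: the Hodge conjecture for all
smooth projective complex varieties GIVEN the (summit-layer) Hodge conjecture
`HodgeTheory.HodgeConjectureFor A.dim A.X` for every complex abelian variety A that is smooth
projective of dimension A.dim (rev 2, cone repair: the hypothesis hA : IsSmoothProjective A.dim A.X
is carried explicitly; EVERY abelian variety has it — tree theorem
`AbelianVariety.isSmoothProjective_holds`, Motives/AbelianVarietyProjectiveChart — so the statement
is equivalent to the rev-1 one, but the route file no longer imports that module's fact-laden cone).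
Present only so that the deciding theorem reaches `HodgeConjecture` (D-0027); under this line's own
philosophy it would further reduce, CONDITIONALLY on Cons, to Murre's Chow–Künneth conjecture for
all X plus 'Hodge classes are motivated' (André Thm 0.4) — see Two-layer plan. Any route proving the
summit outright supersedes it. Do not staff. [difficulty: open-problem] -/
@[route_item "route-HodgeConjecture-CMComplexitySaturation", crux]
def AbelianComplement : Prop :=
  (∀ A : Literature.AlgebraicGeometry.Motives.AbelianVariety ℂ, Literature.AlgebraicGeometry.Motives.IsSmoothProjective A.dim A.X → Literature.AlgebraicGeometry.HodgeTheory.HodgeConjectureFor A.dim A.X) → HodgeConjecture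

/-- item stmt-HodgeConjecture-20099 · support · rank 9 · closed · proved by Summit.HodgeConjecture.HodgeConjecture.Theorems.cmComplexitySaturation_hodgeModels_proof @ a20995471f1d (prover) · by planner
sources: Literature.AlgebraicGeometry.HodgeTheory.HodgeModelExistence
[support] Shared support stmt-HodgeConjecture-1943 (PROVED in Theorems:
`nodalSupport_hodgeModels_proof`): every ℂ-scheme carries the tree's Hodge-model data
`nonempty_hodgeModel n X`, used only to unfold `HodgeConjectureFor` via
`hodgeConjectureFor_iff_of_isSmoothProjective`. [difficulty: provable-now] -/
@[route_item "route-HodgeConjecture-CMComplexitySaturation", crux]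
def HodgeModels : Prop :=
  ∀ (n : ℕ) (X : Literature.AlgebraicGeometry.Motives.SchemeOver ℂ), Literature.AlgebraicGeometry.HodgeTheory.nonempty_hodgeModel n X

/-- item stmt-HodgeConjecture-20100 · assembly · rank 1 · open · by planner
sources: Deligne1982HodgeCycles
[assembly] CMAbelianHodge → MumfordTateFamily → BoundedStrataClosed → UniformCMComplexity →
HodgeModels → AbelianComplement → the Hodge conjecture. -/
@[route_item "route-HodgeConjecture-CMComplexitySaturation"]
def Assembly : Prop :=
  CMAbelianHodge → MumfordTateFamily → BoundedStrataClosed → UniformCMComplexity → HodgeModels → AbelianComplement → _root_.HodgeConjecture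

/-! D-0027 §2.1 — DECIDING THEOREM (planner-authored via `route open/edit --closes-file`; by planner-type-b949f9ea46-0 2026-08-17T19:11:23Z):
its hypotheses are this route's items and its conclusion the sub-problem Statement (glue_lint), and it elaborates with this file. -/

@[closes "route-HodgeConjecture-CMComplexitySaturation"] theorem closes (hT : CMAbelianHodge) (hFam : MumfordTateFamily) (hCl : BoundedStrataClosed)
    (hU : UniformCMComplexity) (hM : HodgeModels) (hR : AbelianComplement) : _root_.HodgeConjecture := by
  refine hR fun A hA => ?_
  refine (Literature.AlgebraicGeometry.HodgeTheory.hodgeConjectureFor_iff_of_isSmoothProjective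
    (hM A.dim A.X) hA).2 ?_
  intro p ω₀ hrat hpp
  -- the Hodge-generic family of `A` with dense CM fibres, and the flat extension `Ω` of `ω₀`
  obtain ⟨𝒜, V, h𝒜, f, x₀, e, hint, hlft, H, CM, hf, h𝒜q, hVq, hVsm, hVirr, hH, hab, hdense, hcm,
    hext⟩ := hFam A hA
  obtain ⟨Ω, hΩ₀, hΩ⟩ := hext p ω₀ hrat hpp
  -- uniform CM complexity: a bounded-degree stratum meets the CM set in a Zariski-dense set
  -- (algebraicity at the CM fibres is the residual `CMAbelianHodge`, transported along `B.X ≅ 𝒜_s`)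
  obtain ⟨δ, hδ⟩ := hU f A.dim hf h𝒜q hVq hVsm hVirr H hH hab CM hdense
    (fun s hs => by
      obtain ⟨B, hB, -, -, hS⟩ := hcm s hs
      exact ⟨B, hB, hS⟩) p Ω hΩ
    (fun s hs => by
      obtain ⟨B, ⟨eB⟩, hBdim, hBsp, S, hS₁, hS₂, hS₃⟩ := hcm s hs
      have hHC := (hT B hBsp ⟨S, hS₁, hS₂, hS₃⟩).2 p
      rw [hBdim] at hHC
      exact (Literature.AlgebraicGeometry.HodgeTheory.forall_hodgeClass_mem_algebraicClasses_iff_of_iso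
        eB p).1 hHC _ (hΩ s).1 (hΩ s).2)
  -- the stratum is Zariski closed on points (`BoundedStrataClosed`), hence it is everything
  have huniv := hδ _ (hCl f A.dim hf h𝒜q hVq hVsm H hH p Ω δ) (fun s hs => hs.2)
  have hx₀ := Set.eq_univ_iff_forall.1 huniv x₀
  -- in particular the class is algebraic at `x₀`, i.e. on `A`
  rw [← hΩ₀]
  exact (Literature.AlgebraicGeometry.HodgeTheory.mem_algebraicClasses_map_iff_of_iso e).2
    (Literature.AlgebraicGeometry.HodgeTheory.cycleDegreeSpan_le_algebraicClasses _ δ p hx₀)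

end Summit.HodgeConjecture.HodgeConjecture.Theses.CMComplexitySaturation
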